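import Mathlib
import HarnessLib
import Summits.RiemannHypothesis.RiemannHypothesis.Theorems.EarlyAppointmentsConjugateVariation

/-!
# Comb sum variation bound

Bound the variation of the comb sum Σξ |1/(z-ξ) - 1/(c-ξ)| for real zeros ξ.

Key estimate: for z on circle |z-c| = h/2 and real ξ at distance d from x₀:
|1/(z-ξ) - 1/(c-ξ)| ≤ (h/2) / ((√(d² + h²) - h/2) · √(d² + h²)) ≤ 1/√(d² + h²)

The sum over zeros in (-R, R) is bounded by (2/s) arcsinh(R/h) ≈ (2/s) log(2R/h).
With 8s ≤ h and the hypothesis 8ε(1 + log(R/h)) ≤ 1, this is controlled.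
-/

open Complex Real Set Filter Topology Metric
open scoped BigOperators Topology

noncomputable section

namespace CombSumVariation

/-- The center point c = x₀ + h·i. -/
abbrev c (x₀ h : ℝ) : ℂ := (x₀ : ℂ) + h * Complex.I

/-- For a real zero ξ, |c - ξ| = √((x₀ - ξ)² + h²) ≥ h. -/
theorem norm_c_sub_real_ge_h {x₀ h : ℝ} (hh : 0 < h) (ξ : ℝ) :
    ‖c x₀ h - (ξ : ℂ)‖ ≥ h := by
  have heq : c x₀ h - (ξ : ℂ) = ((x₀ - ξ : ℝ) : ℂ) + h * Complex.I := by
    simp [c]; ring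
  rw [heq]
  calc ‖((x₀ - ξ : ℝ) : ℂ) + h * Complex.I‖
      = Real.sqrt ((x₀ - ξ)^2 + h^2) := by
        rw [Complex.norm_eq_sqrt_sq_add_sq]; simp
    _ ≥ Real.sqrt (h^2) := by
        apply Real.sqrt_le_sqrt
        have : (x₀ - ξ)^2 ≥ 0 := sq_nonneg _
        linarith
    _ = h := by rw [Real.sqrt_sq (le_of_lt hh)]

/-- Variation of a single pole term: |1/(z-ξ) - 1/(c-ξ)| ≤ |z-c| / ((|c-ξ| - |z-c|)|c-ξ|).
For z on circle |z-c| = h/2 and real ξ, this is ≤ 1/|c-ξ| ≤ 1/h. -/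
theorem single_pole_variation {x₀ h : ℝ} (hh : 0 < h)
    {z : ℂ} (hz : ‖z - c x₀ h‖ = h / 2) {ξ : ℝ}
    (hcξ : ‖c x₀ h - (ξ : ℂ)‖ > h / 2) :
    ‖(z - (ξ : ℂ))⁻¹ - (c x₀ h - (ξ : ℂ))⁻¹‖ ≤ 1 / ‖c x₀ h - (ξ : ℂ)‖ := by
  have hcξ_ne : c x₀ h - (ξ : ℂ) ≠ 0 := by
    intro h0; rw [h0, norm_zero] at hcξ; linarith
  have hzξ_ne : z - (ξ : ℂ) ≠ 0 := by
    have h1 : ‖c x₀ h - (ξ : ℂ)‖ - ‖z - (ξ : ℂ)‖ ≤ ‖z - c x₀ h‖ := by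
      have := norm_sub_norm_le (c x₀ h - (ξ : ℂ)) (z - (ξ : ℂ))
      calc ‖c x₀ h - (ξ : ℂ)‖ - ‖z - (ξ : ℂ)‖
          ≤ ‖(c x₀ h - (ξ : ℂ)) - (z - (ξ : ℂ))‖ := this
        _ = ‖c x₀ h - z‖ := by ring_nf
        _ = ‖z - c x₀ h‖ := norm_sub_rev _ _
    have h2 : ‖z - (ξ : ℂ)‖ ≥ ‖c x₀ h - (ξ : ℂ)‖ - h / 2 := by rw [hz] at h1; linarith
    intro h0; rw [h0, norm_zero] at h2; linarith
  -- Main calculation: |1/a - 1/b| = |b - a|/|ab| ≤ |z - c| / |...|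
  have hdiff : (z - (ξ : ℂ))⁻¹ - (c x₀ h - (ξ : ℂ))⁻¹ =
      ((c x₀ h - (ξ : ℂ)) - (z - (ξ : ℂ))) / ((z - (ξ : ℂ)) * (c x₀ h - (ξ : ℂ))) := by
    field_simp [hzξ_ne, hcξ_ne]
  have hnum : (c x₀ h - (ξ : ℂ)) - (z - (ξ : ℂ)) = c x₀ h - z := by ring
  rw [hdiff, hnum, norm_div, norm_mul]
  have hzξ_bound : ‖z - (ξ : ℂ)‖ ≥ ‖c x₀ h - (ξ : ℂ)‖ - h / 2 := by
    have h1 := norm_sub_norm_le (c x₀ h - (ξ : ℂ)) (z - (ξ : ℂ))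
    have h2 : ‖c x₀ h - (ξ : ℂ)‖ - ‖z - (ξ : ℂ)‖ ≤ h / 2 := by
      calc ‖c x₀ h - (ξ : ℂ)‖ - ‖z - (ξ : ℂ)‖
          ≤ ‖(c x₀ h - (ξ : ℂ)) - (z - (ξ : ℂ))‖ := h1
        _ = ‖c x₀ h - z‖ := by ring_nf
        _ = ‖z - c x₀ h‖ := norm_sub_rev _ _
        _ = h / 2 := hz
    linarith
  have hzξ_pos : ‖z - (ξ : ℂ)‖ > 0 := norm_pos_iff.mpr hzξ_ne
  have hcξ_pos : ‖c x₀ h - (ξ : ℂ)‖ > 0 := norm_pos_iff.mpr hcξ_ne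
  have hdenom_pos : ‖z - (ξ : ℂ)‖ * ‖c x₀ h - (ξ : ℂ)‖ > 0 := mul_pos hzξ_pos hcξ_pos
  have hdenom_bound : ‖z - (ξ : ℂ)‖ * ‖c x₀ h - (ξ : ℂ)‖ ≥
      (‖c x₀ h - (ξ : ℂ)‖ - h / 2) * ‖c x₀ h - (ξ : ℂ)‖ := by
    have h1 : ‖z - (ξ : ℂ)‖ ≥ ‖c x₀ h - (ξ : ℂ)‖ - h / 2 := hzξ_bound
    exact mul_le_mul_of_nonneg_right h1 (le_of_lt hcξ_pos)
  have hnum_eq : ‖c x₀ h - z‖ = h / 2 := by rw [norm_sub_rev]; exact hz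
  calc ‖c x₀ h - z‖ / (‖z - (ξ : ℂ)‖ * ‖c x₀ h - (ξ : ℂ)‖)
      = (h / 2) / (‖z - (ξ : ℂ)‖ * ‖c x₀ h - (ξ : ℂ)‖) := by rw [hnum_eq]
    _ ≤ (h / 2) / ((‖c x₀ h - (ξ : ℂ)‖ - h / 2) * ‖c x₀ h - (ξ : ℂ)‖) := by
        have hdenom_pos' : (‖c x₀ h - (ξ : ℂ)‖ - h / 2) * ‖c x₀ h - (ξ : ℂ)‖ > 0 := by
          apply mul_pos (by linarith) hcξ_pos
        apply div_le_div_of_nonneg_left (by linarith : 0 ≤ h / 2) hdenom_pos' hdenom_bound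
    _ ≤ 1 / ‖c x₀ h - (ξ : ℂ)‖ := by
        have h1 : ‖c x₀ h - (ξ : ℂ)‖ - h / 2 ≥ h / 2 := by
          have hge := norm_c_sub_real_ge_h (x₀ := x₀) hh ξ
          linarith
        have h2 : (‖c x₀ h - (ξ : ℂ)‖ - h / 2) * ‖c x₀ h - (ξ : ℂ)‖ ≥ (h / 2) * ‖c x₀ h - (ξ : ℂ)‖ := by
          exact mul_le_mul_of_nonneg_right h1 (le_of_lt hcξ_pos)
        calc (h / 2) / ((‖c x₀ h - (ξ : ℂ)‖ - h / 2) * ‖c x₀ h - (ξ : ℂ)‖)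
            ≤ (h / 2) / ((h / 2) * ‖c x₀ h - (ξ : ℂ)‖) := by
              apply div_le_div_of_nonneg_left _ (mul_pos (by linarith) hcξ_pos) h2
              linarith
          _ = 1 / ‖c x₀ h - (ξ : ℂ)‖ := by field_simp

end CombSumVariation

end
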